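import Literature.Analysis.OperatorTheory.Enflo2023.CaseIIModel
import Literature.Analysis.OperatorTheory.Enflo2023.Vy
import HarnessLib

/-!
# Enflo 2023, v2 eq. (27): the window refutation for the ACTUAL norm-minimal `ℓ'` of (26), and a genuine-operator model

Source under adjudication: Per H. Enflo, *On the invariant subspace problem in Hilbert spaces*, arXiv:2305.15442 (v1
2023, v2 2024), bib key `Enflo2023` — a CLAIMED proof of the invariant subspace problem for operators on a separable
Hilbert space.  This file is part of the kernel-tight typing of the manuscript by the b2b-enflo repair cell
(formaliser 1, Part A: v2 eq. (1)–(27), the set-up, the constructions `V_y`, `ℓ'`, `[ ]x₀`, Lemma 1 and Case I/II of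
the main step).  It records what FOLLOWS (proved implications from the manuscript's displayed hypotheses) and, where a
step does not follow, the typed inference together with its refutation.  NOTHING here asserts that the manuscript's
main theorem holds; no declaration concludes the invariant subspace problem for an arbitrary operator.  Value
(BLOCK-2b): theorems / refutations of typed inferences about a text — not progress on the problem.

WHAT THIS FILE ADDS TO `CaseII.lean` / `CaseIIModel.lean`.  `CaseII.eq27_false_in_window` refutes (27) for ANY
coefficient data `(a₀, a₁, tail t)` obeying the norm budget, the tail bound and the two Lagrange identities, with
`w` standing for `Ty`.  Those four "standing facts" were justified in prose (GAP.md §F1) from the norm-minimality of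
`ℓ'` in (26).  Here that last prose link is kernel-checked: for a bounded operator `T` with `‖T‖ ≤ 10⁻²⁰` (v2 p.2,
p.8: "`‖u₁(T)‖_op ≤ 10⁻²⁰`"), the paper's `V_y` on `ℓ²` (`Vy.V`, eq. (2)) and the ACTUAL minimal solution `a ∈ ℓ²`
of problem (1) at a radius `ε' < 1` for which `(1+δ)y`, `δ = εθ/10`, is feasible (this is (26): "`(1+δ)y` moves `y`
into the ball", eq. (10)), we DERIVE
  * the budget `|a₀|² + Σ_{j≥1}|a_j|² ≤ (1+δ)²` (minimality against the feasible competitor `(1+δ)e₀`),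
  * `|a₁| ≤ (Σ_{j≥1}|a_j|²)^{1/2} = ‖L a‖` (`L` = left shift),
  * the tail identity `V_y a = a₀ y + a₁ Ty + T²V_y(L²a)` and the bound `‖T²V_y(L²a)‖ ≤ ‖L a‖·10⁻⁴⁰`,
  * the Lagrange identities `⟨y, x₀ − V_y a⟩ = C a₀`, `⟨Ty, x₀ − V_y a⟩ = C a₁` (eq. (5) in coordinates,
    `Vy.kkt_coord` from `IsMinimal.kkt`), and `‖Ty‖ ≤ 10⁻²⁰`,
and conclude from `CaseII.eq27_false_in_window`:  **`‖V_y a − (1+δ)y‖ ≥ (εθ)²`, i.e. (27) is false for the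
minimiser itself**, whenever `(x₀, y, Ty)` lies in the window `10⁻³⁵ ≤ εθ ≤ 10⁻²³`, `0.3 ≤ ‖x₀ − y‖ ≤ 0.7`,
Case II `|⟨Ty, x₀ − y⟩| ≤ (εθ)⁴`, `|⟨y,Ty⟩| ≥ 10⁻²¹`, `dist(Ty, ℂy) ≥ 10⁻²¹` (`eq27_false_for_minimal`).
Second, a MODEL WITH A GENUINE OPERATOR: on any Hilbert space containing an orthonormal triple, the rank-one
operator `T x = ‖y‖⁻²⟨y, x⟩ w` (data `x₀, y, w` of `CaseIIModel.lean`) has `‖T‖ ≤ 10⁻²⁰`, `Ty = w`, satisfies the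
window, and problem (1) for `V_y` at `ε' = ‖x₀ − (1+δ)y‖ < 1` HAS a minimal solution (`exists_isMinimal`, `ℓ²`
complete); the refutation fires on it (`minimal_window_satisfiable`, `eq27_false_for_minimal_fires`, in `ℂ³`).
So the (27) verdict is stated and shown non-vacuous on the manuscript's own objects `T`, `V_y`, `ℓ'`.
Conventions: Mathlib's `⟪u, v⟫_ℂ` is conjugate-linear in `u`; the paper's `⟨u, v⟩` is `⟪v, u⟫_ℂ`.  No new axioms.
-/

open scoped InnerProductSpace ENNReal
open Literature.Analysis.UnboundedOperators (inner_self_eq_coe_norm_sq)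

noncomputable section

namespace Literature.Analysis.OperatorTheory.Enflo2023

section Minimal

variable {H : Type*} [NormedAddCommGroup H] [InnerProductSpace ℂ H] [CompleteSpace H]

namespace Vy

/-- `V_y (c e₀) = c y`: the scalar multiples of `y` are the images of the multiples of `e₀`. [cite: Enflo2023, v2 p.2, eq. (2)] -/
lemma V_smul_single_zero (T : H →L[ℂ] H) (hT : ‖T‖ < 1) (y : H) (c : ℂ) :
    V T hT y (c • (lp.single 2 0 (1 : ℂ) : ℓ2)) = c • y := by
  rw [map_smul, V_single, pow_zero, one_apply_eq_self]

/-- `‖c e₀‖ = |c|` in `ℓ²`. [folklore] -/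
lemma norm_smul_single_zero (c : ℂ) : ‖c • (lp.single 2 0 (1 : ℂ) : ℓ2)‖ = ‖c‖ := by
  rw [norm_smul, lp.norm_single (by norm_num : (0 : ℝ≥0∞) < 2), norm_one, mul_one]

/-- **Budget from minimality** (the "`‖ℓ'‖₂ ≤ 1+δ`" of (26)–(27), v2 p.13, via eq. (10)): if `(1+δ)y` — more
generally `c y`, `c ≥ 0` — lies in the `ε`-ball around `x₀`, the minimal solution of (1) has `‖a‖ ≤ c`. [cite: Enflo2023, v2 p.13, eq. (26)] -/
theorem norm_minimal_le_of_smul_feasible (T : H →L[ℂ] H) (hT : ‖T‖ < 1) {x₀ y : H} {ε : ℝ} {a : ℓ2}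
    {c : ℝ} (hc : 0 ≤ c) (ha : IsMinimal (V T hT y) x₀ ε a) (hfeas : ‖x₀ - (c : ℂ) • y‖ ≤ ε) :
    ‖a‖ ≤ c := by
  have hb : ((c : ℂ) • (lp.single 2 0 (1 : ℂ) : ℓ2)) ∈ feasible (V T hT y) x₀ ε := by
    rw [mem_feasible, V_smul_single_zero]; exact hfeas
  have h := ha.norm_le hb
  rwa [norm_smul_single_zero, Complex.norm_real, Real.norm_of_nonneg hc] at h

/-- `|a₁| ≤ ‖L a‖ = (Σ_{j≥1}|a_j|²)^{1/2}` (a coordinate is bounded by the ℓ²-norm). [folklore] -/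
lemma norm_apply_one_le_norm_L (a : ℓ2) : ‖a 1‖ ≤ ‖L a‖ := by
  have h := lp.norm_apply_le_norm (by norm_num : (2 : ℝ≥0∞) ≠ 0) (L a) 0
  rwa [L_apply, zero_add] at h

/-- `‖a‖² = |a₀|² + ‖L a‖²`. [folklore] -/
lemma norm_sq_eq_head_add_L (a : ℓ2) : ‖a‖ ^ 2 = ‖a 0‖ ^ 2 + ‖L a‖ ^ 2 := by
  rw [norm_L_apply_sq]; ring

/-- **Two-step decomposition** `V_y a = a₀ y + a₁ Ty + T²(V_y(L²a))` — the "`ℓ'(T)y = a₀y + a₁Ty + (smaller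
order)`" of v2 pp.12–13. [cite: Enflo2023, v2 pp.12–13] -/
theorem V_decomp₂ (T : H →L[ℂ] H) (hT : ‖T‖ < 1) (y : H) (a : ℓ2) :
    V T hT y a = a 0 • y + a 1 • T y + T (T (V T hT y (L (L a)))) := by
  conv_lhs => rw [V_decomp T hT y a, V_decomp T hT y (L a)]
  rw [L_apply, zero_add, map_add, map_smul, add_assoc]

/-- **Tail bound**: `‖T²(V_y(L²a))‖ ≤ ‖T‖² · ‖y‖(1−‖T‖²)^{-1/2} · ‖L a‖`. [cite: Enflo2023, v2 pp.12–13] -/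
theorem norm_tail₂_le (T : H →L[ℂ] H) (hT : ‖T‖ < 1) (y : H) (a : ℓ2) :
    ‖T (T (V T hT y (L (L a))))‖ ≤ ‖T‖ ^ 2 * (‖y‖ * Real.sqrt (1 / (1 - ‖T‖ ^ 2))) * ‖L a‖ := by
  have h1 : ‖V T hT y (L (L a))‖ ≤ (‖y‖ * Real.sqrt (1 / (1 - ‖T‖ ^ 2))) * ‖L (L a)‖ :=
    (V T hT y).le_of_opNorm_le (norm_V_le T hT y) _
  have h2 : ‖L (L a)‖ ≤ ‖L a‖ := norm_L_apply_le (L a)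
  calc ‖T (T (V T hT y (L (L a))))‖ ≤ ‖T‖ * ‖T (V T hT y (L (L a)))‖ := T.le_opNorm _
    _ ≤ ‖T‖ * (‖T‖ * ‖V T hT y (L (L a))‖) := by gcongr; exact T.le_opNorm _
    _ ≤ ‖T‖ * (‖T‖ * ((‖y‖ * Real.sqrt (1 / (1 - ‖T‖ ^ 2))) * ‖L a‖)) := by
        gcongr ‖T‖ * (‖T‖ * ?_)
        exact h1.trans (by gcongr)
    _ = ‖T‖ ^ 2 * (‖y‖ * Real.sqrt (1 / (1 - ‖T‖ ^ 2))) * ‖L a‖ := by ring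

end Vy

namespace CaseII

omit [CompleteSpace H] in
/-- `‖y‖² = 1 − 2εθ − ‖x₀ − y‖²` when `‖x₀‖ = 1` and `⟨y, x₀ − y⟩ = εθ` (real). [cite: Enflo2023, v2 p.4, eq. (8)] -/
lemma norm_sq_y_eq {x₀ y : H} {et : ℝ} (h0 : ‖x₀‖ = 1) (hey : ⟪x₀ - y, y⟫_ℂ = (et : ℂ)) :
    ‖y‖ ^ 2 = 1 - 2 * et - ‖x₀ - y‖ ^ 2 := by
  have hyy : ⟪y, y⟫_ℂ = ((‖y‖ ^ 2 : ℝ) : ℂ) := inner_self_eq_coe_norm_sq y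
  have hx0y : ⟪x₀, y⟫_ℂ = ((et + ‖y‖ ^ 2 : ℝ) : ℂ) := by
    have h := hey
    rw [inner_sub_left, hyy] at h
    push_cast at h ⊢
    linear_combination h
  have h := norm_sub_sq (𝕜 := ℂ) x₀ y
  rw [hx0y, h0] at h
  simp only [RCLike.re_to_complex, Complex.ofReal_re, one_pow] at h
  linarith

omit [CompleteSpace H] in
/-- `‖Ty‖ ≤ 10⁻²⁰` from `‖T‖ ≤ 10⁻²⁰` and `‖y‖ ≤ 1`. [cite: Enflo2023, v2 p.8 (‖u₁(T)‖_op ≤ 10⁻²⁰)] -/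
lemma norm_apply_le_of_opNorm_le {T : H →L[ℂ] H} {y : H} {r : ℝ} (hr : 0 ≤ r) (hT : ‖T‖ ≤ r)
    (hy : ‖y‖ ≤ 1) : ‖T y‖ ≤ r :=
  (T.le_opNorm y).trans (by nlinarith [norm_nonneg T, norm_nonneg y])

/-- **(27) is false for the minimiser itself.**  `T` bounded with `‖T‖ ≤ 10⁻²⁰`; `‖x₀‖ = 1`; `y` with
`⟨y, x₀ − y⟩ = εθ ∈ [10⁻³⁵, 10⁻²³]`, `‖x₀ − y‖ ∈ [0.3, 0.7]`; Case II at `j = 1`: `|⟨Ty, x₀ − y⟩| ≤ (εθ)⁴`; the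
generic-position window `|⟨y, Ty⟩| ≥ 10⁻²¹`, `dist(Ty, ℂy) ≥ 10⁻²¹`; and `a ∈ ℓ²` THE norm-minimal solution of
(1) for `V_y` at a radius `ε' < 1` at which `(1+δ)y`, `δ = εθ/10`, is feasible (problem (26)).  Then the minimal move
satisfies `‖V_y a − (1+δ)y‖ ≥ (εθ)²` — the manuscript's (27) claims `< (εθ)²`.  All four standing facts fed to
`CaseII.eq27_false_in_window` (budget, tail, Lagrange `j = 0, 1`) are derived here from minimality. [cite: Enflo2023, v2 p.13, eq. (26)–(27)] -/
theorem eq27_false_for_minimal (T : H →L[ℂ] H) (hT1 : ‖T‖ < 1) (hT : ‖T‖ ≤ 1 / 10 ^ 20)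
    (x₀ y : H) (et ε' : ℝ) (a : Vy.ℓ2)
    (h0 : ‖x₀‖ = 1) (hey : ⟪x₀ - y, y⟫_ℂ = (et : ℂ))
    (het1 : 1 / 10 ^ 35 ≤ et) (het2 : et ≤ 1 / 10 ^ 23)
    (hρ1 : 0.3 ≤ ‖x₀ - y‖) (hρ2 : ‖x₀ - y‖ ≤ 0.7)
    (hcase : ‖⟪x₀ - y, T y⟫_ℂ‖ ≤ et ^ 4)
    (hκ : 1 / 10 ^ 21 ≤ ‖⟪y, T y⟫_ℂ‖)
    (hτ : 1 / 10 ^ 21 ≤ ‖T y - (⟪y, T y⟫_ℂ / ((‖y‖ ^ 2 : ℝ) : ℂ)) • y‖)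
    (hmin : IsMinimal (Vy.V T hT1 y) x₀ ε' a) (hε' : ε' < 1)
    (hfeas : ‖x₀ - ((1 + et / 10 : ℝ) : ℂ) • y‖ ≤ ε') :
    et ^ 2 ≤ ‖Vy.V T hT1 y a - ((1 + et / 10 : ℝ) : ℂ) • y‖ := by
  have het0 : 0 < et := lt_of_lt_of_le (by norm_num) het1
  -- the Lagrange identities (5) in coordinates j = 0, 1
  have ha0 : a ≠ 0 := hmin.ne_zero (by rw [h0]; exact hε')
  obtain ⟨C, -, hC⟩ := hmin.kkt ha0
  have hk0 := Vy.kkt_coord T hT1 y x₀ a hC 0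
  have hk1 := Vy.kkt_coord T hT1 y x₀ a hC 1
  rw [pow_zero, one_apply_eq_self] at hk0
  rw [pow_one] at hk1
  -- the decomposition V_y a = a₀ y + a₁ Ty + t
  obtain ⟨t, ht_def⟩ : ∃ t : H, t = T (T (Vy.V T hT1 y (Vy.L (Vy.L a)))) := ⟨_, rfl⟩
  have hVa : Vy.V T hT1 y a = a 0 • y + a 1 • T y + t := by rw [ht_def]; exact Vy.V_decomp₂ T hT1 y a
  rw [hVa] at hk0 hk1 ⊢
  -- the budget from minimality and the coordinate bound
  have hna : ‖a‖ ≤ 1 + et / 10 := Vy.norm_minimal_le_of_smul_feasible T hT1 (by positivity) hmin hfeas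
  have hbudget : ‖a 0‖ ^ 2 + ‖Vy.L a‖ ^ 2 ≤ (1 + et / 10) ^ 2 := by
    rw [← Vy.norm_sq_eq_head_add_L]
    exact pow_le_pow_left₀ (norm_nonneg _) hna 2
  have hn1A : ‖a 1‖ ≤ ‖Vy.L a‖ := Vy.norm_apply_one_le_norm_L a
  -- ‖y‖² ≤ 0.91, hence ‖Ty‖ ≤ 10⁻²⁰ and the tail bound
  have hYeq := norm_sq_y_eq h0 hey
  have hY2 : ‖y‖ ^ 2 ≤ 0.91 := by nlinarith [het0.le]
  have hy1 : ‖y‖ ≤ 1 := by nlinarith [norm_nonneg y]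
  have hw : ‖T y‖ ≤ 1 / 10 ^ 20 := norm_apply_le_of_opNorm_le (by norm_num) hT hy1
  have hq0 : 0 ≤ ‖T‖ := norm_nonneg _
  have hq2 : ‖T‖ ^ 2 ≤ 1 / 10 ^ 40 := by
    have := pow_le_pow_left₀ hq0 hT 2
    exact this.trans (by norm_num)
  have hpos : 0 < 1 - ‖T‖ ^ 2 := by nlinarith
  have hs0 : 0 ≤ Real.sqrt (1 / (1 - ‖T‖ ^ 2)) := Real.sqrt_nonneg _
  have hys2 : (‖y‖ * Real.sqrt (1 / (1 - ‖T‖ ^ 2))) ^ 2 ≤ 1 := by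
    rw [mul_pow, Real.sq_sqrt (by positivity), one_div, ← div_eq_mul_inv, div_le_one hpos]
    nlinarith
  have hys : ‖y‖ * Real.sqrt (1 / (1 - ‖T‖ ^ 2)) ≤ 1 := by
    nlinarith [mul_nonneg (norm_nonneg y) hs0]
  have ht : ‖t‖ ≤ ‖Vy.L a‖ / 10 ^ 40 := by
    rw [ht_def]
    have h := Vy.norm_tail₂_le T hT1 y a
    have hL0 : 0 ≤ ‖Vy.L a‖ := norm_nonneg _
    calc ‖T (T (Vy.V T hT1 y (Vy.L (Vy.L a))))‖
        ≤ ‖T‖ ^ 2 * (‖y‖ * Real.sqrt (1 / (1 - ‖T‖ ^ 2))) * ‖Vy.L a‖ := h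
      _ ≤ (1 / 10 ^ 40) * 1 * ‖Vy.L a‖ := by gcongr
      _ = ‖Vy.L a‖ / 10 ^ 40 := by ring
  exact eq27_false_in_window x₀ y (T y) t (a 0) (a 1) (C : ℂ) ‖Vy.L a‖ et h0 hey het1 het2 hρ1 hρ2 hw
    hcase hκ hτ hn1A hbudget ht hk0 hk1

/-- The same verdict with the move measured against `(εθ)²` explicitly as a strict failure of (27):
`¬ (‖ℓ'(T)y − (1+δ)y‖ < (εθ)²)`. [cite: Enflo2023, v2 p.13, eq. (27)] -/
theorem not_eq27_for_minimal (T : H →L[ℂ] H) (hT1 : ‖T‖ < 1) (hT : ‖T‖ ≤ 1 / 10 ^ 20)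
    (x₀ y : H) (et ε' : ℝ) (a : Vy.ℓ2)
    (h0 : ‖x₀‖ = 1) (hey : ⟪x₀ - y, y⟫_ℂ = (et : ℂ))
    (het1 : 1 / 10 ^ 35 ≤ et) (het2 : et ≤ 1 / 10 ^ 23)
    (hρ1 : 0.3 ≤ ‖x₀ - y‖) (hρ2 : ‖x₀ - y‖ ≤ 0.7)
    (hcase : ‖⟪x₀ - y, T y⟫_ℂ‖ ≤ et ^ 4)
    (hκ : 1 / 10 ^ 21 ≤ ‖⟪y, T y⟫_ℂ‖)
    (hτ : 1 / 10 ^ 21 ≤ ‖T y - (⟪y, T y⟫_ℂ / ((‖y‖ ^ 2 : ℝ) : ℂ)) • y‖)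
    (hmin : IsMinimal (Vy.V T hT1 y) x₀ ε' a) (hε' : ε' < 1)
    (hfeas : ‖x₀ - ((1 + et / 10 : ℝ) : ℂ) • y‖ ≤ ε') :
    ¬ (‖Vy.V T hT1 y a - ((1 + et / 10 : ℝ) : ℂ) • y‖ < et ^ 2) :=
  not_lt.2 (eq27_false_for_minimal T hT1 hT x₀ y et ε' a h0 hey het1 het2 hρ1 hρ2 hcase hκ hτ hmin hε' hfeas)

end CaseII

end Minimal

/-! ### A model with a genuine operator: `T x = ‖y‖⁻² ⟨y, x⟩ w` on the data of `CaseIIModel.lean` -/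

section Model

variable {H : Type*} [NormedAddCommGroup H] [InnerProductSpace ℂ H]

namespace CaseII

namespace WindowModel

variable (e : Fin 3 → H)

/-- The rank-one operator `T x = ‖y‖⁻² ⟪y, x⟫ w` (so `Ty = w`). [cite: Enflo2023, v2 p.13, eq. (27)] -/
def Top : H →L[ℂ] H :=
  ((1 / ‖y e‖ ^ 2 : ℝ) : ℂ) • (innerSL ℂ (y e)).smulRight (w e)

/-- Unfolding `T x = ‖y‖⁻² ⟪y, x⟫ w`. [cite: Enflo2023, v2 p.13, eq. (27)] -/
lemma Top_apply (x : H) : Top e x = ((1 / ‖y e‖ ^ 2 : ℝ) : ℂ) • (⟪y e, x⟫_ℂ • w e) := by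
  simp [Top, ContinuousLinearMap.smulRight_apply]

variable {e}

section inner
variable (he : Orthonormal ℂ e)
include he

/-- `‖y‖² = 16/25 + q²` (between `0.79` and `0.8`). [cite: Enflo2023, v2 p.13, eq. (27)] -/
lemma norm_sq_y : ‖y e‖ ^ 2 = (4 / 5) ^ 2 + q ^ 2 := norm_sq_of_inner _ _ (inner_y_y he)

/-- `Ty = w`. [cite: Enflo2023, v2 p.13, eq. (27)] -/
lemma Top_y : Top e (y e) = w e := by
  have hy2 : ‖y e‖ ^ 2 ≠ 0 := by rw [norm_sq_y he, q_def]; norm_num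
  rw [Top_apply, inner_self_eq_coe_norm_sq, smul_smul, ← Complex.ofReal_mul, one_div,
    inv_mul_cancel₀ hy2, Complex.ofReal_one, one_smul]

/-- `‖T‖ ≤ 10⁻²⁰` (indeed `‖T‖ ≤ ‖w‖/‖y‖ ≈ 3·10⁻²¹`). [cite: Enflo2023, v2 p.13, eq. (27)] -/
lemma norm_Top_le : ‖Top e‖ ≤ 1 / 10 ^ 20 := by
  have hy2 := norm_sq_y he
  have hw2 := norm_sq_w he
  -- ‖w‖ ≤ 3·10⁻²¹ and ‖y‖ ≥ 0.88
  have hwle : ‖w e‖ ≤ 3 / 10 ^ 21 := by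
    have : ‖w e‖ ^ 2 ≤ (3 / 10 ^ 21) ^ 2 := by rw [hw2, alpha_def, beta_def, q_def]; norm_num
    exact (pow_le_pow_iff_left₀ (norm_nonneg _) (by norm_num) two_ne_zero).1 this
  have hyge : 0.88 ≤ ‖y e‖ := by
    have : (0.88 : ℝ) ^ 2 ≤ ‖y e‖ ^ 2 := by rw [hy2, q_def]; norm_num
    exact (pow_le_pow_iff_left₀ (by norm_num) (norm_nonneg _) two_ne_zero).1 this
  have hy0 : 0 < ‖y e‖ := lt_of_lt_of_le (by norm_num) hyge
  refine ContinuousLinearMap.opNorm_le_bound _ (by norm_num) (fun x => ?_)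
  rw [Top_apply, norm_smul, norm_smul, Complex.norm_real, Real.norm_of_nonneg (by positivity)]
  have hcs : ‖⟪y e, x⟫_ℂ‖ ≤ ‖y e‖ * ‖x‖ := norm_inner_le_norm (𝕜 := ℂ) _ _
  calc 1 / ‖y e‖ ^ 2 * (‖⟪y e, x⟫_ℂ‖ * ‖w e‖) ≤ 1 / ‖y e‖ ^ 2 * ((‖y e‖ * ‖x‖) * (3 / 10 ^ 21)) := by
        gcongr
    _ = (3 / 10 ^ 21 / ‖y e‖) * ‖x‖ := by field_simp
    _ ≤ (3 / 10 ^ 21 / 0.88) * ‖x‖ := by gcongr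
    _ ≤ 1 / 10 ^ 20 * ‖x‖ := mul_le_mul_of_nonneg_right (by norm_num) (norm_nonneg x)

/-- `‖T‖ < 1`. [cite: Enflo2023, v2 p.13, eq. (27)] -/
lemma norm_Top_lt_one : ‖Top e‖ < 1 := (norm_Top_le he).trans_lt (by norm_num)

/-- The radius of (26): `ε' := ‖x₀ − (1+δ)y‖ < 1` (`≤ 0.7 + δ‖y‖`). [cite: Enflo2023, v2 p.13, eq. (26)] -/
lemma radius_lt_one : ‖x0 e - ((1 + et / 10 : ℝ) : ℂ) • y e‖ < 1 := by
  obtain ⟨-, -, ⟨het1, het2⟩, ⟨-, hρ2⟩, -⟩ := hypotheses he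
  have hy2 := norm_sq_y he
  have hyle : ‖y e‖ ≤ 1 := by
    have : ‖y e‖ ^ 2 ≤ 1 := by rw [hy2, q_def]; norm_num
    exact (pow_le_one_iff_of_nonneg (norm_nonneg _) two_ne_zero).1 this
  have hsplit : x0 e - ((1 + et / 10 : ℝ) : ℂ) • y e = (x0 e - y e) - ((et / 10 : ℝ) : ℂ) • y e := by
    push_cast
    rw [add_smul, one_smul]
    abel
  rw [hsplit]
  calc ‖(x0 e - y e) - ((et / 10 : ℝ) : ℂ) • y e‖ ≤ ‖x0 e - y e‖ + ‖((et / 10 : ℝ) : ℂ) • y e‖ :=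
        norm_sub_le _ _
    _ ≤ 0.7 + et / 10 * 1 := by
        rw [norm_smul, Complex.norm_real, Real.norm_of_nonneg (by linarith)]
        gcongr
    _ < 1 := by linarith

variable [CompleteSpace H]

/-- **The genuine-operator window is inhabited, with its minimiser.**  For `T = Top`, the data `x₀, y` of
`CaseIIModel.lean`, `εθ = et`, `ε' = ‖x₀ − (1+δ)y‖`: all hypotheses of `eq27_false_for_minimal` hold for SOME
`a ∈ ℓ²` — the minimal solution of (1), which exists because `(1+δ)e₀` is feasible and `ℓ²` is complete. [cite: Enflo2023, v2 p.13, eq. (26)–(27)] -/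
theorem minimal_hypotheses :
    ∃ a : Vy.ℓ2,
      ‖Top e‖ ≤ 1 / 10 ^ 20 ∧ ‖x0 e‖ = 1 ∧ ⟪x0 e - y e, y e⟫_ℂ = ((et : ℝ) : ℂ) ∧
      (1 / 10 ^ 35 ≤ et ∧ et ≤ 1 / 10 ^ 23) ∧ ((0.3 : ℝ) ≤ ‖x0 e - y e‖ ∧ ‖x0 e - y e‖ ≤ 0.7) ∧
      ‖⟪x0 e - y e, Top e (y e)⟫_ℂ‖ ≤ et ^ 4 ∧ 1 / 10 ^ 21 ≤ ‖⟪y e, Top e (y e)⟫_ℂ‖ ∧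
      1 / 10 ^ 21 ≤ ‖Top e (y e) - (⟪y e, Top e (y e)⟫_ℂ / ((‖y e‖ ^ 2 : ℝ) : ℂ)) • y e‖ ∧
      IsMinimal (Vy.V (Top e) (norm_Top_lt_one he) (y e)) (x0 e) (‖x0 e - ((1 + et / 10 : ℝ) : ℂ) • y e‖) a ∧
      ‖x0 e - ((1 + et / 10 : ℝ) : ℂ) • y e‖ < 1 ∧
      ‖x0 e - ((1 + et / 10 : ℝ) : ℂ) • y e‖ ≤ ‖x0 e - ((1 + et / 10 : ℝ) : ℂ) • y e‖ := by
  obtain ⟨h0, hey, het, hρ, -, hcase, hκ, hτ, -⟩ := hypotheses he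
  have hfeas : ((((1 + et / 10 : ℝ) : ℂ)) • (lp.single 2 0 (1 : ℂ) : Vy.ℓ2)) ∈
      feasible (Vy.V (Top e) (norm_Top_lt_one he) (y e)) (x0 e) (‖x0 e - ((1 + et / 10 : ℝ) : ℂ) • y e‖) := by
    rw [mem_feasible, Vy.V_smul_single_zero]
  obtain ⟨a, ha⟩ := exists_isMinimal _ _ _ ⟨_, hfeas⟩
  refine ⟨a, norm_Top_le he, h0, hey, het, hρ, ?_, ?_, ?_, ha, radius_lt_one he, le_rfl⟩
  · rw [Top_y he]; exact hcase
  · rw [Top_y he]; exact hκ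
  · rw [Top_y he]; exact hτ

/-- The refutation FIRES on the genuine-operator model: the minimal move of (26) for `T = Top` is at least `(εθ)²`
(applying `eq27_false_for_minimal`; so that theorem is not vacuously true). [cite: Enflo2023, v2 p.13, eq. (27)] -/
theorem eq27_false_for_minimal_fires :
    ∃ a : Vy.ℓ2,
      IsMinimal (Vy.V (Top e) (norm_Top_lt_one he) (y e)) (x0 e) (‖x0 e - ((1 + et / 10 : ℝ) : ℂ) • y e‖) a ∧
      et ^ 2 ≤ ‖Vy.V (Top e) (norm_Top_lt_one he) (y e) a - ((1 + et / 10 : ℝ) : ℂ) • y e‖ := by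
  obtain ⟨a, hT, h0, hey, ⟨het1, het2⟩, ⟨hρ1, hρ2⟩, hcase, hκ, hτ, ha, hε', hfeas⟩ := minimal_hypotheses he
  exact ⟨a, ha, eq27_false_for_minimal (Top e) (norm_Top_lt_one he) hT (x0 e) (y e) et _ a h0 hey het1 het2
    hρ1 hρ2 hcase hκ hτ ha hε' hfeas⟩

end inner

end WindowModel

/-- **Satisfiability in `ℂ³` with a genuine operator and its genuine minimiser**: there are a bounded operator `T`
with `‖T‖ ≤ 10⁻²⁰`, vectors `x₀, y`, a value `εθ` and a radius `ε' < 1` meeting every hypothesis of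
`eq27_false_for_minimal`, together with THE minimal solution `a` of (1) — and the move is `≥ (εθ)²`. [cite: Enflo2023, v2 p.13, eq. (26)–(27)] -/
theorem minimal_window_satisfiable :
    ∃ (T : EuclideanSpace ℂ (Fin 3) →L[ℂ] EuclideanSpace ℂ (Fin 3)) (hT1 : ‖T‖ < 1)
      (x₀ y : EuclideanSpace ℂ (Fin 3)) (et ε' : ℝ) (a : Vy.ℓ2),
      ‖T‖ ≤ 1 / 10 ^ 20 ∧ ‖x₀‖ = 1 ∧ ⟪x₀ - y, y⟫_ℂ = (et : ℂ) ∧ (1 / 10 ^ 35 ≤ et ∧ et ≤ 1 / 10 ^ 23) ∧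
      ((0.3 : ℝ) ≤ ‖x₀ - y‖ ∧ ‖x₀ - y‖ ≤ 0.7) ∧ ‖⟪x₀ - y, T y⟫_ℂ‖ ≤ et ^ 4 ∧ 1 / 10 ^ 21 ≤ ‖⟪y, T y⟫_ℂ‖ ∧
      1 / 10 ^ 21 ≤ ‖T y - (⟪y, T y⟫_ℂ / ((‖y‖ ^ 2 : ℝ) : ℂ)) • y‖ ∧
      IsMinimal (Vy.V T hT1 y) x₀ ε' a ∧ ε' < 1 ∧ ‖x₀ - ((1 + et / 10 : ℝ) : ℂ) • y‖ ≤ ε' ∧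
      et ^ 2 ≤ ‖Vy.V T hT1 y a - ((1 + et / 10 : ℝ) : ℂ) • y‖ := by
  let e : Fin 3 → EuclideanSpace ℂ (Fin 3) := fun i => EuclideanSpace.basisFun (Fin 3) ℂ i
  have he : Orthonormal ℂ e := (EuclideanSpace.basisFun (Fin 3) ℂ).orthonormal
  obtain ⟨a, hT, h0, hey, het, hρ, hcase, hκ, hτ, ha, hε', hfeas⟩ := WindowModel.minimal_hypotheses he
  exact ⟨WindowModel.Top e, WindowModel.norm_Top_lt_one he, WindowModel.x0 e, WindowModel.y e, WindowModel.et,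
    _, a, hT, h0, hey, het, hρ, hcase, hκ, hτ, ha, hε', hfeas,
    eq27_false_for_minimal _ _ hT _ _ _ _ a h0 hey het.1 het.2 hρ.1 hρ.2 hcase hκ hτ ha hε' hfeas⟩

end CaseII

end Model

end Literature.Analysis.OperatorTheory.Enflo2023

end
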